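import Mathlib
import Summits.ValiantsHypothesis.ValiantsHypothesis.Theorems.ValuativeGCTValuativeFlipPencilEvalCheck
import Summits.ValiantsHypothesis.ValiantsHypothesis.Theorems.ValuativeGCTValuativeFlipHeadCensusPointwise

/-!
# Certified small case `N = 9`: the four-row census FLIPS at `(n, m) = (9, 10)`, above the bottom

Helper file (`--supports stmt-ValiantsHypothesis-12624`, computational lane: one `native_decide`) for
crux `ValuativeGCT.ValuativeFlip`, line `four-row-count`, wall-breaker axis k14 "small cases certified".

* `pencilCheck_eight` — the evaluation certificate of
  `Theorems/ValuativeGCTValuativeFlipPencilEvalCheck.lean` at inner size `N = 9` (`n = 8`, `P = 240`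
  points, `r = 220`) evaluates to `true` (`native_decide`; ≈ 2 min in the interpreter: 240 × 9 subset
  DPs of depth 9, Gaussian elimination of a `324 × 240` matrix and a `220 × 220` inverse modulo
  `1000003`, product check);
* `pencilRank_nine` — hence `220 = C(12,3) ≤ dim span{X_t · (∂_{kl} per_9)(M·X)}` for the integer
  pencil `M = pencilZ 8`: the four-variable pencil family of `per_9` spans ALL quaternary nonics
  (`le_finrank_of_pencilCheck`) — the line card's generic value `min(C(n+3,3), 4n²-2n+2)` at `n = 9`,
  now a theorem;
* `fourRow_census_nine_ten`, `flipBody_nine_ten`, `detObstruction_nine_ten` — since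
  `2·10² + 10 + 2 = 212 ≤ 220`, the pointwise head census (`headFlipBody_of_pencilCert_at` of `…HeadOfPencilCertificate.lean`,
  `fourRow_*_of_pencilRank` of `…HeadCensusPointwise.lean`) gives at `(n, m) = (9, 10)`:
  a four-row shape `λ ⊢ 10δ` with `dim (Hom_{10δ} ⊓ SAND ⊓ HWSP(λ*)) < mult_{λ*} ℂ[Δ_10(X₀₀ per_9)]`, the
  body of the crux `ValuativeGCT.ValuativeFlip` at `(9, 10)` (centre `U = ⊥`), and a Mulmuley–Sohoni
  multiplicity obstruction `mult_{λ*} ℂ[Δ(det_10)] < mult_{λ*} ℂ[Δ_10(X₀₀ · per_9)]` on a four-row shape.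
  This is the first window position ABOVE THE BOTTOM (`m = n + 1`) at which a flip is a theorem of the
  tree (the bottom `m = n` is `ValuativeGCTValuativeFlipBottomWindow`; `(8, 9)` is out of reach of the
  four-row count since `2·9²+9+2 = 173 > 165 = C(11,3)`).
[this crux's line four-row-count; Mulmuley–Sohoni 2008; BLMW 2011 §5.2] [folklore]
-/

set_option linter.dupNamespace false
set_option maxHeartbeats 800000

namespace Summit.ValiantsHypothesis.ValiantsHypothesis.Theorems.ValuativeFlip

open MvPolynomial
open scoped BigOperators Matrix
open Literature.NumberTheory.DiophantineGeometry
open Literature.Computability.AlgebraicComplexity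

/-- **The certificate at `N = 9` checks** (`n = 8`, `240` points, rank `220`). [compute: native_decide,
in-file] [folklore] -/
theorem pencilCheck_eight : pencilCheck 8 240 220 = true := by
  native_decide

/-- **Rank 220 at inner size 9**: the pencil family `X_t · (∂_{kl} per_9)(M·X)` of the integer pencil
`M = pencilZ 8` spans `≥ 220 = C(12,3)` dimensions, i.e. all quaternary forms of degree `9`.
[this crux's line four-row-count (generic value `min(C(n+3,3), 4n²-2n+2)`); folklore] -/
theorem pencilRank_nine :
    220 ≤ Module.finrank ℂ ↥(Submodule.span ℂ (Set.range fun tc : Fin 4 × (Fin 9 × Fin 9) =>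
      (X tc.1 : MvPolynomial (Fin 4) ℂ) *
        aeval (fun ij : Fin 9 × Fin 9 =>
          ∑ t : Fin 4, (fun ij t => ((pencilZ 8 ij t : ℤ) : ℂ)) ij t • (X t : MvPolynomial (Fin 4) ℂ))
          (pderiv tc.2 (perPoly (Fin 9) ℂ)))) :=
  le_finrank_of_pencilCheck 8 240 220 pencilCheck_eight

/-- **The four-row census flips at `(n, m) = (9, 10)`**: some `λ ⊢ 10δ` with at most four rows has
`dim (Hom_{10δ} ⊓ SAND ⊓ HWSP(λ*)) < mult_{λ*} ℂ[Δ_10(X₀₀ · per_9)]`. [this crux's line four-row-count;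
folklore] -/
theorem fourRow_census_nine_ten :
    ∃ (δ : ℕ) (lam : Nat.Partition (10 * δ)), lam.parts.card ≤ 4 ∧
        Module.finrank ℂ ↥(MvPolynomial.homogeneousSubmodule (MatIdx 10 × MatIdx 10) ℂ (10 * δ) ⊓
          (⨅ (P : Matrix (Fin 10) (Fin 10) ℂ) (Q : Matrix (Fin 10) (Fin 10) ℂ) (_ : P.det = 1) (_ : Q.det = 1), LinearMap.ker ((MvPolynomial.aeval fun p : MatIdx 10 × MatIdx 10 => ∑ l : MatIdx 10, (P (ofLex p.2).1 (ofLex l).1 * Q (ofLex l).2 (ofLex p.2).2) • (MvPolynomial.X (p.1, l) : MvPolynomial (MatIdx 10 × MatIdx 10) ℂ)).toLinearMap - (LinearMap.id : MvPolynomial (MatIdx 10 × MatIdx 10) ℂ →ₗ[ℂ] MvPolynomial (MatIdx 10 × MatIdx 10) ℂ))) ⊓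
          (⨅ (g : Matrix.GeneralLinearGroup (MatIdx 10) ℂ) (_ : IsUpperTriangular g), LinearMap.ker ((MvPolynomial.aeval fun p : MatIdx 10 × MatIdx 10 => ∑ l : MatIdx 10, ((g⁻¹ : Matrix.GeneralLinearGroup (MatIdx 10) ℂ) : Matrix (MatIdx 10) (MatIdx 10) ℂ) p.1 l • (MvPolynomial.X (l, p.2) : MvPolynomial (MatIdx 10 × MatIdx 10) ℂ)).toLinearMap - weightChar ((Weight.dualOfPartition (10 * 10) lam).toMatIdx : Weight (MatIdx 10)) g • (LinearMap.id : MvPolynomial (MatIdx 10 × MatIdx 10) ℂ →ₗ[ℂ] MvPolynomial (MatIdx 10 × MatIdx 10) ℂ)))) <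
        orbitMultiplicity ℂ (paddedPerFormLex ℂ 9 10) 10 ((Weight.dualOfPartition (10 * 10) lam).toMatIdx : Weight (MatIdx 10)) :=
  fourRow_census_of_pencilRank 9 10 (by norm_num) (by norm_num) (fun ij t => ((pencilZ 8 ij t : ℤ) : ℂ))
    (fun t' : Fin 4 => ((0 : Fin (8 + 1)), Fin.castLE (by norm_num) t')) (pencilZ_cells_isUnit 8 (by norm_num))
    (le_trans (by norm_num) pencilRank_nine)

/-- **The crux body at `(9, 10)`**: the body of `ValuativeGCT.ValuativeFlip` (verbatim `let χ`, `let T`)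
holds at `n = 9`, `m = 10` — a valuative flip ABOVE the bottom of the window, certified. [this crux's
line four-row-count; folklore] -/
theorem flipBody_nine_ten :
    ∃ (U : Submodule ℂ (MatIdx 10 → ℂ)) (r δ : ℕ) (lam : Nat.Partition (10 * δ)), (∀ u ∈ U, (Matrix.of fun a b : Fin 10 => u (toLex (a, b))).rank ≤ r) ∧ lam.parts.card ≤ 10 * 10 ∧ (let χ : Weight (MatIdx 10) := (Weight.dualOfPartition (10 * 10) lam).toMatIdx; let T : Submodule ℂ (MvPolynomial (MatIdx 10 × MatIdx 10) ℂ) := MvPolynomial.homogeneousSubmodule (MatIdx 10 × MatIdx 10) ℂ (10 * δ) ⊓ ((MvPolynomial.vanishingIdeal ℂ {p : MatIdx 10 × MatIdx 10 → ℂ | ∀ j : MatIdx 10, (fun i => p (j, i)) ∈ U}) ^ (δ * (10 - r))).restrictScalars ℂ ⊓ (⨅ (M : Matrix (MatIdx 10) (MatIdx 10) ℂ) (_ : linSubst (MatIdx 10) ℂ M (detFormLex ℂ 10) = detFormLex ℂ 10), LinearMap.ker ((MvPolynomial.aeval (R := ℂ) fun p : MatIdx 10 × MatIdx 10 => ∑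 l : MatIdx 10, M l p.2 • MvPolynomial.X (p.1, l)).toLinearMap - LinearMap.id (R := ℂ) (M := MvPolynomial (MatIdx 10 × MatIdx 10) ℂ))) ⊓ (⨅ (g : Matrix.GeneralLinearGroup (MatIdx 10) ℂ) (_ : IsUpperTriangular g), LinearMap.ker ((MvPolynomial.aeval (R := ℂ) fun p : MatIdx 10 × MatIdx 10 => ∑ l : MatIdx 10, ((g⁻¹ : Matrix.GeneralLinearGroup (MatIdx 10) ℂ) : Matrix (MatIdx 10) (MatIdx 10) ℂ) p.1 l • MvPolynomial.X (l, p.2)).toLinearMap - weightChar χ g • LinearMap.id (R := ℂ) (M := MvPolynomial (MatIdx 10 × MatIdx 10) ℂ))); Module.finrank ℂ ↥T < orbitMultiplicity ℂ (paddedPerFormLex ℂ 9 10) 10 χ) :=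
  headFlipBody_of_pencilCert_at 9 10 (by norm_num) (by norm_num) (fun ij t => ((pencilZ 8 ij t : ℤ) : ℂ))
    (fun t' : Fin 4 => ((0 : Fin (8 + 1)), Fin.castLE (by norm_num) t')) (pencilZ_cells_isUnit 8 (by norm_num))
    (le_trans (by norm_num) pencilRank_nine)

/-- **A multiplicity obstruction at `(9, 10)`**: some four-row `λ ⊢ 10δ` has
`mult_{λ*} ℂ[Δ(det_10)] < mult_{λ*} ℂ[Δ_10(X₀₀ · per_9)]` — a Mulmuley–Sohoni multiplicity obstruction for
the determinant versus the padded permanent above the bottom of the window, certified.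
[Mulmuley–Sohoni 2008; BLMW 2011 §5.2; this crux's line four-row-count] [folklore] -/
theorem detObstruction_nine_ten :
    ∃ (δ : ℕ) (lam : Nat.Partition (10 * δ)), lam.parts.card ≤ 4 ∧
      orbitMultiplicity ℂ (detFormLex ℂ 10) 10 ((Weight.dualOfPartition (10 * 10) lam).toMatIdx : Weight (MatIdx 10)) <
        orbitMultiplicity ℂ (paddedPerFormLex ℂ 9 10) 10 ((Weight.dualOfPartition (10 * 10) lam).toMatIdx : Weight (MatIdx 10)) :=
  fourRow_detObstruction_of_pencilRank 9 10 (by norm_num) (by norm_num) (fun ij t => ((pencilZ 8 ij t : ℤ) : ℂ))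
    (fun t' : Fin 4 => ((0 : Fin (8 + 1)), Fin.castLE (by norm_num) t')) (pencilZ_cells_isUnit 8 (by norm_num))
    (le_trans (by norm_num) pencilRank_nine)

end Summit.ValiantsHypothesis.ValiantsHypothesis.Theorems.ValuativeFlip
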